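import Summits.QuantumAdvantage.AdviceFreeQNC0.WalkFailSetHits
import Summits.QuantumAdvantage.AdviceFreeQNC0.WalkCoreHub
import HarnessLib

/-!
# Cell qa-qnc0 (rung F-Q1, route `RingFrame`, crux α `RingToElim`): the TUBE BOUND — typed
# targets of planner qa-qnc0-p2's ROUND-11 (`HOME/qa-qnc0-p2/ROUND-11.md`, `line/Sketch11.lean`)

Statements VERBATIM from `Sketch11.lean` (ns `QaQnc0.Sketch11p2` there; here in the cell topic's
namespace so that the provers of P11-A/B/C/D share ONE copy): the far tube `farSet`, the fail set
`failSetOf`, the targets `TubeBallMinor` (T11-1), `BallAveraging` (T11-2), `TubeBound` (T11-3),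
`TubeMass` (T11-4), `BinomTailLower` (T11-5), `TubePlan` (T11-6), and the bookkeeping
`tubeBound_of` (PROVED, as in the sketch).  The two RingFrame-dependent tails of the sketch
(`walkHardAll_ringToElim`, `ringToElim_of_tubePlan`) belong to the route's `Theorems/` file
(P11-D) and are NOT here (a topic file does not import the Theses file).

CLAIM STATUS (ROUND-11 §0): T11-1…T11-6 ⊢ `WalkHardAll` ⊢ `RingHard 2` ⊢ α; nothing in this file is
a proof of any target.  WHAT THIS IS NOT: no separation claim; statements only (plus `tubeBound_of`).
-/

noncomputable section

open Classical

namespace Summit.QuantumAdvantage.AdviceFreeQNC0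

open Finset
open Literature.Computability.MetaComplexity Literature.Computability.MetaComplexity.Smolensky
open F4

/-- The FAR TUBE of half-width parameter `k` on `m` bits: patterns `a` with `a` and `ā` at Hamming
distance `> k` from every path pattern `aPat g`, i.e. `k < d_g(a) < m − k` for all cuts `g`.
(Sketch11, verbatim.) -/
def farSet (m k : ℕ) : Finset (Fin m → Bool) :=
  univ.filter fun a : Fin m → Bool => ¬ NearPath k a ∧ ¬ NearPath k (conj a)

/-- The fail set `{u : tr (f u) ≠ 1}` of an `𝔽₄`-valued (full) strategy. (Sketch11, verbatim.) -/
def failSetOf {m : ℕ} (f : (Fin m → Bool) → F4) : Finset (Fin m → Bool) :=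
  univ.filter fun u : Fin m → Bool => tr (f u) ≠ 1

/-- **T11-1 `TubeBallMinor`** (the new step; M–L, linear algebra over `𝔽₂`/`𝔽₄`): a full strategy of
degree `D` fails on at least as many inputs as there are far patterns (tube `FAR_{D+D'}`) in any one
Hamming ball of radius `D'`. (Sketch11, verbatim.) -/
def TubeBallMinor : Prop :=
  ∀ (m D D' : ℕ) (f : (Fin m → Bool) → F4), f ∈ fullSpan m D → ∀ v : Fin m → Bool,
    ((farSet m (D' + D)).filter fun a => pdist a v ≤ D').card ≤ (failSetOf f).card

/-- **T11-2 `BallAveraging`** (S, double counting): some ball of radius `r` catches at least the average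
share `N_r(m)/2^m` of any set `S` of patterns. (Sketch11, verbatim.) -/
def BallAveraging : Prop :=
  ∀ (m r : ℕ) (S : Finset (Fin m → Bool)), ∃ v : Fin m → Bool,
    S.card * numMonomials m r ≤ 2 ^ m * (S.filter fun a => pdist a v ≤ r).card

/-- **T11-3 `TubeBound`**: `2^m · #FAIL(f) ≥ |FAR_{D+D'}| · N_{D'}(m)` for every `f ∈ M_D(P)` and every
`D'`. (Sketch11, verbatim.) -/
def TubeBound : Prop :=
  ∀ (m D D' : ℕ) (f : (Fin m → Bool) → F4), f ∈ fullSpan m D →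
    (farSet m (D' + D)).card * numMonomials m D' ≤ 2 ^ m * (failSetOf f).card

/-- T11-3 from T11-1 and T11-2 (bookkeeping, proved; Sketch11, verbatim). -/
theorem tubeBound_of (h₁ : TubeBallMinor) (h₂ : BallAveraging) : TubeBound := by
  intro m D D' f hf
  obtain ⟨v, hv⟩ := h₂ m D' (farSet m (D' + D))
  exact le_trans hv (Nat.mul_le_mul_left _ (h₁ m D D' f hf v))

/-- **T11-4 `TubeMass`** (M, reflection principle + Chebyshev in counting form): for some absolute `C`,
the tube of half-width `C·√m` around the centre of the band holds at least half of all patterns.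
(Sketch11, verbatim.) -/
def TubeMass : Prop :=
  ∃ C m₀ : ℕ, ∀ m ≥ m₀, 2 ^ m ≤ 2 * (farSet m (m / 2 - C * Nat.sqrt m)).card

/-- **T11-5 `BinomTailLower`** (M, elementary): the binomial lower tail at `C√m` below the mean has
constant mass: `N_{⌊m/2⌋ − t}(m) ≥ c·2^m` for all `t ≤ C√m`, `m ≥ m₀`. (Sketch11, verbatim.) -/
def BinomTailLower : Prop :=
  ∀ C : ℕ, ∃ c : ℝ, 0 < c ∧ ∃ m₀ : ℕ, ∀ m ≥ m₀, ∀ t : ℕ, t ≤ C * Nat.sqrt m →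
    c * (2 : ℝ) ^ m ≤ (numMonomials m (m / 2 - t) : ℝ)

/-- **T11-6 `TubePlan`** (S–M, assembly): the three estimates give walk hardness at every charge and
every polylog degree (`D' = ⌊m/2⌋ − C√m − D`, `m = n`, `θ = 1 − c/4`). (Sketch11, verbatim.) -/
def TubePlan : Prop := TubeBound → TubeMass → BinomTailLower → WalkHardAll

end Summit.QuantumAdvantage.AdviceFreeQNC0

end
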